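import Summits.PneNP.PneNP.Theorems.ChebyshevTracialDesignRungPieces
import Summits.PneNP.PneNP.Theorems.ChebyshevTracialDesignRungConstants
import Summits.PneNP.PneNP.Theorems.ChebyshevTracialDesignBoundedDimension
import HarnessLib

/-!
# Cell pnp-psdrank, route `ChebyshevTracialDesign`: the `r = 1` RUNG at the exp scale, modulo Keevash–Lifshitz Thm 1.8 —
# every balanced Chebyshev design has mass `≤ exp(−a·dq n)` on every tight-free rectangle

Harmonic backbone of the crux `TracialDecayExp20` (stmt-PneNP-19878), brick 32 (prover g8; step S6, MEMO-10 §3; planner p1 N2-SpreadStructure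
§SNT (2)). THEOREM `rectangleDecayExp_of_globalLevelD`: assume the named fact `GlobalLevelDInequality` [cite: KeevashLifshitz2023, Thm. 1.8]. Then
for some `a > 0` and all large even `n`, every balanced exact design `(t, C, w)` of degree `dq n` on levels `≤ Tq n` with `Σ|w_c| ≤ 20` and every
TIGHT-FREE rectangle `A × B` (`A` odd cuts, `B` perfect matchings, `|δ(U) ∩ M| ≠ 1` throughout) satisfy `Σ_{U∈A} Σ_{M∈B} W(U,M) ≤ exp(−a·dq n)` — the
`r = 1` shadow of the crux (planner p1's `stub_rung_r1Exp`; the hypothesis of the tree's `…BoundedDim.tracialDecay_boundedDim_of_rectangleDecay`,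
which upgrades it to the crux at every bounded dimension, see `tracialDecayExp_boundedDim_of_globalLevelD`). It re-proves Rothvoß-type
exponential decay `exp(−Ω(n^{1/4}))` for the matching polytope's slack by a different certificate (Chebyshev design + spread approximation).
PROOF (as formalised). `W` vanishes off the `t`-cuts, so `A` may be taken inside the `t`-cuts. Kupavskii–Zakharov spread approximation of the edge
sets of `B` among all perfect matchings with `τ = e`, `q = ⌈a·D⌉ + 4` (`D = dq n`, lit `spreadApproximation`, modified stopping rule):
`B = B' ⊔ ⊔_i B_i`. §1 `abs_value_le_three_terms`: `|V(A×B)| ≤ B_v·[τ^{−(q+1)} + τ^{q+1}n^q·4^q·√P_{D−4} + β·τ^{q+1}]` — remainder by the column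
marginal (brick 30) and `ν(B') ≤ τ^{−(q+1)}`; pieces by brick 31 `abs_piece_value_le` (crossing cells via the crossing-pin lemma, non-crossing cells
via SNT in `K_{n−2|S_i|}`, brick 29, giving `β = exp(−c₀(D−1))`), their number `k ≤ τ^{q+1}n^q` and `Σ_i ν(⟨S_i⟩) ≤ τ^{q+1}`. The three terms are
each `≤ exp(−aD)/3` for `a = c₀/80` and `D` large (`…RungConstants`; `P_{D−4} ≤ (2/D³)^κ`, `κ = ⌊(D−4)/2⌋+1 ≥ 18q+18`). §2 the theorem and its
bounded-dimension upgrade. [cite: Rothvoss2017, §2 and Lemma 7 (PDF pp. 6–8)] [cite: KupavskiiZakharov2022, Lemma 11] [cite: KeevashLifshitz2023, Thm. 1.8]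
Stature: support/instrument — a CONDITIONAL (on KL Thm 1.8) theorem about 0/1 rectangles; by `tracialDecay_boundedDim_of_rectangleDecay` also the
crux for psd rectangles of any FIXED dimension. WHAT THIS IS NOT: not the crux `TracialDecayExp20` (dimension `r` up to `exp(a·dq n/2)`), no proof of
KL Thm 1.8, nothing on psd rank beyond bounded dimension, no P-vs-NP content. Supports stmt-PneNP-19878.
-/

set_option linter.dupNamespace false -- `Summit.PneNP.PneNP.…`: summit = sub-problem (D-0017)

noncomputable section

namespace Summit.PneNP.PneNP.Theorems.ChebyshevTracialDesignRungAssembly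

open Finset Literature.Combinatorics.Optimization
open Literature.Barriers.PneNP hiding verts
open Literature.Combinatorics.SetFamily
open Literature.Combinatorics.SimpleGraph.CycleSpace
open Literature.Combinatorics.AssociationSchemes.CutMatchingRestriction
open Literature.Combinatorics.AssociationSchemes.HomogeneousMatchingFamilies
open Literature.Combinatorics.Additive.KeevashLifshitz
open Summit.PneNP.PneNP.Theorems.ChebyshevTracialDesignProfilePolynomial (card_pmatch_pos)
open Summit.PneNP.PneNP.Theorems.ChebyshevTracialDesignDipoleHitRatio (card_pmatch_eq_pmCount)
open Summit.PneNP.PneNP.Theorems.ChebyshevTracialDesignRungCells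
open Summit.PneNP.PneNP.Theorems.ChebyshevTracialDesignRungPieces
open Summit.PneNP.PneNP.Theorems.ChebyshevTracialDesignSpectralNonTightnessEstimates
open Summit.PneNP.PneNP.Theorems.ChebyshevTracialDesignSpectralNonTightnessWide
open Summit.PneNP.PneNP.Theorems.ChebyshevTracialDesignBoundedDim (tracialDecay_boundedDim_of_rectangleDecay)
open Summit.PneNP.PneNP.Theorems.ChebyshevTracialDesignRungConstants

variable {n : ℕ}

/-! ### §1 The value of a tight-free rectangle through the spread approximation: three terms -/

/-- `W(U, M) = 0` unless `|U| = t`. [cite: Rothvoss2017, §2 (PDF p. 6)] -/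
theorem levelWeight_eq_zero_of_card_ne {t : ℕ} (C : Finset ℕ) (w : ℕ → ℝ) {U : OddSet n} (hU : U.1.card ≠ t) (M : PMatch n) :
    levelWeight n t C w U M = 0 := by
  unfold levelWeight
  exact sum_eq_zero fun c _ => by rw [if_neg]; intro h; exact hU (mem_Qset_iff.1 h).1

/-- The remainder of the spread approximation, in `PMatch` currency, has the cardinality of KZ's `ℱ'`. [cite: KupavskiiZakharov2022, Lemma 11] -/
theorem card_filter_mem_eq (Y : Finset (PMatch n)) {P : Finset (Finset (Sym2 (Fin n)))} (hP : P ⊆ Y.image Subtype.val) :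
    (Y.filter fun M => M.1 ∈ P).card = P.card := by
  have h := congrArg Finset.card (image_val_filter_mem_eq Y hP)
  rw [card_image_of_injective _ Subtype.val_injective] at h
  exact h

/-- **Splitting the rectangle along the spread approximation**: `Σ_{M∈Y} g(M) = Σ_{M∈Y, M∈ℱ'} g(M) + Σ_i Σ_{M∈Y, M∈ℱ_i} g(M)`.
[cite: KupavskiiZakharov2022, Lemma 11] -/
theorem sum_eq_remainder_add_pieces {β : Type*} [AddCommMonoid β] (Y : Finset (PMatch n)) {τ : ℝ} {q : ℕ}
    (Dk : SpreadApproximation (perfectMatchings (univ : Finset (Fin n))) (Y.image Subtype.val) τ q) (g : PMatch n → β) :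
    ∑ M ∈ Y, g M = ∑ M ∈ Y.filter (fun M => M.1 ∈ Dk.remainder), g M + ∑ i : Fin Dk.k, ∑ M ∈ Y.filter (fun M => M.1 ∈ Dk.piece i), g M := by
  classical
  have hcover : Y = Y.filter (fun M => M.1 ∈ Dk.remainder) ∪ (univ : Finset (Fin Dk.k)).biUnion (fun i => Y.filter (fun M => M.1 ∈ Dk.piece i)) := by
    ext M
    simp only [mem_union, mem_filter, mem_biUnion, mem_univ, true_and]
    constructor
    · intro hM
      have hMF : M.1 ∈ Y.image Subtype.val := mem_image_of_mem _ hM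
      rw [← Dk.remainder_union_biUnion, mem_union, mem_biUnion] at hMF
      rcases hMF with h | ⟨i, -, hi⟩
      · exact Or.inl ⟨hM, h⟩
      · exact Or.inr ⟨i, hM, hi⟩
    · rintro (⟨hM, -⟩ | ⟨i, hM, -⟩) <;> exact hM
  have hdisj1 : Disjoint (Y.filter (fun M => M.1 ∈ Dk.remainder))
      ((univ : Finset (Fin Dk.k)).biUnion (fun i => Y.filter (fun M => M.1 ∈ Dk.piece i))) := by
    rw [disjoint_biUnion_right]
    intro i _
    rw [disjoint_filter]
    intro M _ hrem hpi
    exact disjoint_left.1 (Dk.disjoint_remainder_piece i) hrem hpi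
  have hdisj2 : ∀ i ∈ (univ : Finset (Fin Dk.k)), ∀ j ∈ (univ : Finset (Fin Dk.k)), i ≠ j →
      Disjoint (Y.filter (fun M => M.1 ∈ Dk.piece i)) (Y.filter (fun M => M.1 ∈ Dk.piece j)) := by
    intro i _ j _ hij
    rw [disjoint_filter]
    intro M _ hi hj
    exact disjoint_left.1 (Dk.disjoint i j hij) hi hj
  conv_lhs => rw [hcover]
  rw [sum_union hdisj1, sum_biUnion hdisj2]

/-- **The three-term bound.** For `n` even, an exact design `(n, t = 2c'+1, T, D, B_v, C, w)` with `4 ≤ D ≤ 2c'`, `n ≤ 4t`, a family `A` of `t`-cuts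
and a set `Y` of perfect matchings with `A × Y` tight-free, a spread approximation `Dk` of the edge sets of `Y` (parameter `τ > 0`, cores `≤ q`, `40q ≤ n`,
`1 ≤ n`), and spectral non-tightness in the reduced instances (threshold `exp(−c₀ dq m) ≤ β` for `n − 2q ≤ m ≤ n`, range `n₁ + 2q ≤ n`):
`|Σ_{U∈A}Σ_{M∈Y} W| ≤ B_v·((τ^{q+1})⁻¹ + τ^{q+1}·n^q·(4^q·√P_{D−4}) + β·τ^{q+1})`. [cite: KupavskiiZakharov2022, Lemma 11] [cite: Rothvoss2017, §2 (PDF p. 6)] -/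
theorem abs_value_le_three_terms {c' T Dg q n₁ : ℕ} {Bv τ c₀ β : ℝ} {C : Finset ℕ} {w : ℕ → ℝ} (hn : Even n) (hn1 : 1 ≤ n)
    (hdes : IsExactDesign n (2 * c' + 1) T Dg Bv C w) (hDg : Dg ≤ 2 * c') (hDg4 : 4 ≤ Dg)
    (hbal : n ≤ 4 * (2 * c' + 1)) (hq : 40 * q ≤ n) (hn₁ : n₁ + 2 * q ≤ n) (hτ : 0 < τ)
    (hSNT : ∀ (m t : ℕ), n₁ ≤ m → Even m → Odd t → m ≤ 5 * t → m ≤ 5 * (m - t) →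
      ∀ (X : Finset (OddSet m)), (∀ U ∈ X, U.1.card = t) →
      ∀ (Y' : Finset (PMatch m)), IsRelHomogeneous τ (perfectMatchings (univ : Finset (Fin m))) (Y'.image Subtype.val) →
      Real.exp (-(c₀ * dq m)) ≤ (X.card : ℝ) / (m.choose t : ℝ) →
      Real.exp (-(c₀ * dq m)) ≤ (Y'.card : ℝ) / (Fintype.card (PMatch m) : ℝ) → ∃ U ∈ X, ∃ M ∈ Y', cc U M = 1)
    (hβ : ∀ m : ℕ, n ≤ m + 2 * q → m ≤ n → Real.exp (-(c₀ * dq m)) ≤ β) (hβ0 : 0 ≤ β)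
    (A : Finset (OddSet n)) (hA : ∀ U ∈ A, U.1.card = 2 * c' + 1) (Y : Finset (PMatch n))
    (hAY : ∀ U ∈ A, ∀ M ∈ Y, cc U M ≠ 1)
    (Dk : SpreadApproximation (perfectMatchings (univ : Finset (Fin n))) (Y.image Subtype.val) τ q) :
    |∑ U ∈ A, ∑ M ∈ Y, levelWeight n (2 * c' + 1) C w U M| ≤
      Bv * ((τ ^ (q + 1))⁻¹ + τ ^ (q + 1) * (n : ℝ) ^ q *
        ((4 : ℝ) ^ q * Real.sqrt (∏ j ∈ range ((Dg - 4) / 2 + 1), ((2 * j + 1 : ℝ) / ((n : ℝ) - 2 * j)))) + β * τ ^ (q + 1)) := by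
  classical
  have hBv : 0 ≤ Bv := (sum_nonneg fun c _ => abs_nonneg (w c)).trans hdes.2.2.2.2.2.2
  have hPM : (0 : ℝ) < Fintype.card (PMatch n) := by exact_mod_cast card_pmatch_pos hn
  have h𝒜 : ((perfectMatchings (univ : Finset (Fin n))).card : ℝ) = Fintype.card (PMatch n) := by
    rw [card_pmatch_eq_pmCount, pmCount]
  have h𝒜ne : (perfectMatchings (univ : Finset (Fin n))).Nonempty := by
    rw [← card_pos]; exact_mod_cast (h𝒜 ▸ hPM : (0 : ℝ) < ((perfectMatchings (univ : Finset (Fin n))).card : ℝ))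
  set P : ℝ := ∏ j ∈ range ((Dg - 4) / 2 + 1), ((2 * j + 1 : ℝ) / ((n : ℝ) - 2 * j)) with hPdef
  -- split along the spread approximation
  have hsplit : ∑ U ∈ A, ∑ M ∈ Y, levelWeight n (2 * c' + 1) C w U M =
      ∑ U ∈ A, ∑ M ∈ Y.filter (fun M => M.1 ∈ Dk.remainder), levelWeight n (2 * c' + 1) C w U M +
        ∑ i : Fin Dk.k, ∑ U ∈ A, ∑ M ∈ Y.filter (fun M => M.1 ∈ Dk.piece i), levelWeight n (2 * c' + 1) C w U M := by
    rw [sum_comm (s := univ), ← sum_add_distrib]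
    exact sum_congr rfl fun U _ => sum_eq_remainder_add_pieces Y Dk _
  rw [hsplit]
  -- the remainder
  have hrem : |∑ U ∈ A, ∑ M ∈ Y.filter (fun M => M.1 ∈ Dk.remainder), levelWeight n (2 * c' + 1) C w U M| ≤ Bv * (τ ^ (q + 1))⁻¹ := by
    refine (abs_sum_sum_levelWeight_le_col _ C w A _).trans ?_
    refine mul_le_mul hdes.2.2.2.2.2.2 ?_ (by positivity) hBv
    rw [card_filter_mem_eq Y Dk.remainder_subset, ← h𝒜]
    exact Dk.card_remainder_div_le hτ h𝒜ne
  -- the pieces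
  have hpieces : ∀ i : Fin Dk.k, |∑ U ∈ A, ∑ M ∈ Y.filter (fun M => M.1 ∈ Dk.piece i), levelWeight n (2 * c' + 1) C w U M| ≤
      (4 : ℝ) ^ q * (Bv * Real.sqrt P) +
        β * Bv * (((supersets (perfectMatchings (univ : Finset (Fin n))) (Dk.core i)).card : ℝ) / Fintype.card (PMatch n)) :=
    fun i => abs_piece_value_le hn hdes hDg hDg4 hbal hq hn₁ hSNT hβ hβ0 A hA Y hAY Dk i
  have hsumpieces : |∑ i : Fin Dk.k, ∑ U ∈ A, ∑ M ∈ Y.filter (fun M => M.1 ∈ Dk.piece i), levelWeight n (2 * c' + 1) C w U M| ≤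
      τ ^ (q + 1) * (n : ℝ) ^ q * ((4 : ℝ) ^ q * (Bv * Real.sqrt P)) + β * Bv * τ ^ (q + 1) := by
    refine (abs_sum_le_sum_abs _ _).trans ((sum_le_sum fun i _ => hpieces i).trans ?_)
    rw [sum_add_distrib, sum_const, card_univ, Fintype.card_fin, nsmul_eq_mul, ← mul_sum]
    have hk := card_pieces_le hn hn1 Y hτ Dk
    have hstars : ∑ i : Fin Dk.k, (((supersets (perfectMatchings (univ : Finset (Fin n))) (Dk.core i)).card : ℝ) / Fintype.card (PMatch n)) ≤
        τ ^ (q + 1) := by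
      rw [← h𝒜]
      refine (Dk.sum_card_supersets_div_le hτ.le h𝒜ne).trans ?_
      have hY1 : ((Y.image Subtype.val).card : ℝ) / (perfectMatchings (univ : Finset (Fin n))).card ≤ 1 := by
        rw [div_le_one (by rw [h𝒜]; exact hPM), h𝒜, card_image_of_injective _ Subtype.val_injective]
        exact_mod_cast (card_le_univ Y).trans_eq Finset.card_univ
      calc τ ^ (q + 1) * (((Y.image Subtype.val).card : ℝ) / (perfectMatchings (univ : Finset (Fin n))).card)
          ≤ τ ^ (q + 1) * 1 := mul_le_mul_of_nonneg_left hY1 (by positivity)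
        _ = τ ^ (q + 1) := mul_one _
    have h1 : (Dk.k : ℝ) * ((4 : ℝ) ^ q * (Bv * Real.sqrt P)) ≤ τ ^ (q + 1) * (n : ℝ) ^ q * ((4 : ℝ) ^ q * (Bv * Real.sqrt P)) :=
      mul_le_mul_of_nonneg_right hk (by positivity)
    have h2 : β * Bv * ∑ i : Fin Dk.k, (((supersets (perfectMatchings (univ : Finset (Fin n))) (Dk.core i)).card : ℝ) /
        Fintype.card (PMatch n)) ≤ β * Bv * τ ^ (q + 1) := mul_le_mul_of_nonneg_left hstars (by positivity)
    linarith
  calc |∑ U ∈ A, ∑ M ∈ Y.filter (fun M => M.1 ∈ Dk.remainder), levelWeight n (2 * c' + 1) C w U M +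
        ∑ i : Fin Dk.k, ∑ U ∈ A, ∑ M ∈ Y.filter (fun M => M.1 ∈ Dk.piece i), levelWeight n (2 * c' + 1) C w U M|
      ≤ Bv * (τ ^ (q + 1))⁻¹ + (τ ^ (q + 1) * (n : ℝ) ^ q * ((4 : ℝ) ^ q * (Bv * Real.sqrt P)) + β * Bv * τ ^ (q + 1)) :=
        (abs_add_le _ _).trans (add_le_add hrem hsumpieces)
    _ = _ := by ring
/-! ### §2 The `r = 1` rung at the exp scale -/

/-- **THE `r = 1` RUNG AT THE EXP SCALE (modulo Keevash–Lifshitz Thm 1.8).** Assume `GlobalLevelDInequality`. Then there are `a > 0` and `n₁`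
such that for every even `n ≥ n₁`, every balanced exact design `(t, C, w)` of degree `dq n` on levels `≤ Tq n` with `Σ_c |w_c| ≤ 20`, and every
tight-free rectangle `A × B` of odd cuts and perfect matchings of `K_n`: `Σ_{U∈A} Σ_{M∈B} W(U,M) ≤ exp(−a·dq n)`. This is the `r = 1` shadow of the
crux `TracialDecayExp20` (the tree's `rectangleDecay_of_tracialDecayExp20` derives it FROM the crux; here it is proved from KL Thm 1.8).
[cite: Rothvoss2017, §2 and Lemma 7 (PDF pp. 6–8)] [cite: KupavskiiZakharov2022, Lemma 11] [cite: KeevashLifshitz2023, Thm. 1.8] -/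
theorem rectangleDecayExp_of_globalLevelD (hKL : GlobalLevelDInequality) :
    ∃ a : ℝ, 0 < a ∧ ∃ n₁ : ℕ, ∀ n : ℕ, n₁ ≤ n → Even n → ∀ (t : ℕ) (C : Finset ℕ) (w : ℕ → ℝ),
      IsBalancedDesign n t (Tq n) (dq n) 20 C w →
        ∀ (A : Finset (OddSet n)) (B : Finset (PMatch n)), (∀ U ∈ A, ∀ M ∈ B, cc U M ≠ 1) →
          ∑ U ∈ A, ∑ M ∈ B, levelWeight n t C w U M ≤ Real.exp (-(a * (dq n : ℝ))) := by
  classical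
  have hτ1 : (1 : ℝ) ≤ Real.exp 1 := by have := Real.add_one_le_exp (1 : ℝ); linarith
  have hτ0 : (0 : ℝ) < Real.exp 1 := Real.exp_pos 1
  obtain ⟨c₁, hc₁, N₁, hS⟩ := snt_sym_oddSet_of_globalLevelD hKL hτ1
  obtain ⟨c₀, hc₀def⟩ : ∃ c₀ : ℝ, c₀ = min c₁ 1 := ⟨_, rfl⟩
  have hc₀ : 0 < c₀ := by rw [hc₀def]; exact lt_min hc₁ one_pos
  have hc₀1 : c₀ ≤ 1 := by rw [hc₀def]; exact min_le_right _ _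
  have hc₀c₁ : c₀ ≤ c₁ := by rw [hc₀def]; exact min_le_left _ _
  -- SNT at threshold `c₀`
  have hSNT : ∀ (m t : ℕ), N₁ ≤ m → Even m → Odd t → m ≤ 5 * t → m ≤ 5 * (m - t) →
      ∀ (X : Finset (OddSet m)), (∀ U ∈ X, U.1.card = t) →
      ∀ (Y' : Finset (PMatch m)), IsRelHomogeneous (Real.exp 1) (perfectMatchings (univ : Finset (Fin m))) (Y'.image Subtype.val) →
      Real.exp (-(c₀ * dq m)) ≤ (X.card : ℝ) / (m.choose t : ℝ) →
      Real.exp (-(c₀ * dq m)) ≤ (Y'.card : ℝ) / (Fintype.card (PMatch m) : ℝ) → ∃ U ∈ X, ∃ M ∈ Y', cc U M = 1 := by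
    intro m t h1 h2 h3 h4 h5 X hX Y' hY' hdX hdY
    have hmono : Real.exp (-(c₁ * dq m)) ≤ Real.exp (-(c₀ * dq m)) :=
      Real.exp_le_exp.2 (by nlinarith [Nat.cast_nonneg (α := ℝ) (dq m)])
    exact hS m t h1 h2 h3 h4 h5 X hX Y' hY' (hmono.trans hdX) (hmono.trans hdY)
  obtain ⟨a, ha⟩ : ∃ a : ℝ, a = c₀ / 80 := ⟨_, rfl⟩
  have ha0 : 0 < a := by rw [ha]; positivity
  obtain ⟨D₁, hD₁⟩ : ∃ D₁ : ℕ, D₁ = max 500 ⌈16 / c₀⌉₊ := ⟨_, rfl⟩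
  refine ⟨a, ha0, max (2 * N₁ + 8) (D₁ ^ 4), ?_⟩
  intro n hn hev t C w hdes A B hAB
  obtain ⟨hex, hbal⟩ := hdes
  obtain ⟨c', rfl⟩ := hex.1
  -- the size parameter `D = dq n`
  have hN₁ : 2 * N₁ + 8 ≤ n := le_trans (le_max_left _ _) hn
  have hD₁n : D₁ ^ 4 ≤ n := le_trans (le_max_right _ _) hn
  have hD : D₁ ≤ dq n := by
    unfold dq
    rw [Nat.le_sqrt, Nat.le_sqrt]
    calc D₁ * D₁ * (D₁ * D₁) = D₁ ^ 4 := by ring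
      _ ≤ n := hD₁n
  have hD500 : 500 ≤ dq n := le_trans (by rw [hD₁]; exact le_max_left _ _) hD
  have hDc : ⌈16 / c₀⌉₊ ≤ dq n := le_trans (by rw [hD₁]; exact le_max_right _ _) hD
  have hcD : 16 ≤ c₀ * dq n := by
    have h1 : 16 / c₀ ≤ (dq n : ℝ) := (Nat.le_ceil _).trans (by exact_mod_cast hDc)
    rwa [div_le_iff₀ hc₀, mul_comm] at h1
  have hD4n : dq n ^ 4 ≤ n := by
    have h1 : dq n * dq n ≤ Nat.sqrt n := Nat.sqrt_le (Nat.sqrt n)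
    calc dq n ^ 4 = (dq n * dq n) * (dq n * dq n) := by ring
      _ ≤ Nat.sqrt n * Nat.sqrt n := Nat.mul_le_mul h1 h1
      _ ≤ n := Nat.sqrt_le n
  have hD2 : dq n * dq n ≤ dq n ^ 4 := by
    calc dq n * dq n = dq n * dq n * 1 := (mul_one _).symm
      _ ≤ dq n * dq n * (dq n * dq n) := Nat.mul_le_mul_left _ (Nat.one_le_iff_ne_zero.2 (by positivity))
      _ = dq n ^ 4 := by ring
  have h500D : 500 * dq n ≤ n := by nlinarith
  have hnD : n < (dq n + 1) ^ 4 := by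
    have h1 := Nat.lt_succ_sqrt' n
    have h2 := Nat.lt_succ_sqrt' (Nat.sqrt n)
    have h3 : Nat.sqrt n + 1 ≤ (dq n + 1) ^ 2 := h2
    calc n < (Nat.sqrt n + 1) ^ 2 := h1
      _ ≤ ((dq n + 1) ^ 2) ^ 2 := Nat.pow_le_pow_left h3 2
      _ = (dq n + 1) ^ 4 := by ring
  have hn16 : (n : ℝ) ≤ 16 * (dq n : ℝ) ^ 4 := by
    have h1 : n ≤ (2 * dq n) ^ 4 := hnD.le.trans (Nat.pow_le_pow_left (by omega) 4)
    have h2 : ((n : ℕ) : ℝ) ≤ (((2 * dq n) ^ 4 : ℕ) : ℝ) := by exact_mod_cast h1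
    have h3 : (((2 * dq n) ^ 4 : ℕ) : ℝ) = 16 * (dq n : ℝ) ^ 4 := by push_cast; ring
    linarith
  -- the core size `q`
  obtain ⟨q, hq⟩ : ∃ q : ℕ, q = ⌈a * dq n⌉₊ + 4 := ⟨_, rfl⟩
  have hq1 : a * dq n + 5 ≤ (q : ℝ) + 1 := by
    rw [hq]; push_cast; linarith [Nat.le_ceil (a * dq n)]
  have hq2 : (q : ℝ) + 1 ≤ a * dq n + 6 := by
    rw [hq]; push_cast
    have := Nat.ceil_lt_add_one (show 0 ≤ a * dq n by positivity); linarith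
  have hq80 : 80 * q < dq n + 480 := by
    have hcd : c₀ * dq n ≤ dq n := by nlinarith [Nat.cast_nonneg (α := ℝ) (dq n)]
    have h1 : (80 : ℝ) * q < dq n + 480 := by rw [ha] at hq2; linarith
    exact_mod_cast h1
  have hq40 : 40 * q ≤ n := by omega
  have h2q : 2 * q ≤ dq n := by omega
  have hN₁q : N₁ + 2 * q ≤ n := by omega
  have hκ : 18 * q + 18 ≤ (dq n - 4) / 2 + 1 := by omega
  have hn1 : 1 ≤ n := by omega
  -- the design degree
  have hDg : dq n ≤ 2 * c' := by
    have h1 : Tq n ≤ 2 * c' + 1 := hex.2.2.1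
    have h2 : dq n ≤ Nat.sqrt n := Nat.sqrt_le_self _
    unfold Tq at h1; omega
  have hDg4 : 4 ≤ dq n := by omega
  -- the spread approximation of the matching side
  obtain ⟨Dk⟩ := exists_spreadApproximation (image_val_subset B) hτ1 q
  -- the junk threshold `β = exp(−c₀(D−1))`
  have hβ : ∀ m : ℕ, n ≤ m + 2 * q → m ≤ n → Real.exp (-(c₀ * dq m)) ≤ Real.exp (-(c₀ * ((dq n : ℝ) - 1))) := by
    intro m hm1 _
    have hdm : dq n - 1 ≤ dq m := by
      have h1 : (dq n - 1) ^ 4 + dq n ≤ dq n ^ 4 := pred_pow_four_add_le (by omega)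
      have h2 : (dq n - 1) ^ 4 ≤ m := by omega
      show dq n - 1 ≤ Nat.sqrt (Nat.sqrt m)
      rw [Nat.le_sqrt, Nat.le_sqrt]
      calc (dq n - 1) * (dq n - 1) * ((dq n - 1) * (dq n - 1)) = (dq n - 1) ^ 4 := by ring
        _ ≤ m := h2
    apply Real.exp_le_exp.2
    have h3 : ((dq n : ℝ) - 1) ≤ (dq m : ℝ) := by
      have : ((dq n - 1 : ℕ) : ℝ) ≤ dq m := by exact_mod_cast hdm
      rwa [Nat.cast_sub (by omega), Nat.cast_one] at this
    nlinarith
  -- reduce `A` to the `t`-cuts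
  have hAeq : ∑ U ∈ A, ∑ M ∈ B, levelWeight n (2 * c' + 1) C w U M =
      ∑ U ∈ A.filter (fun U => U.1.card = 2 * c' + 1), ∑ M ∈ B, levelWeight n (2 * c' + 1) C w U M := by
    rw [sum_filter]
    refine sum_congr rfl fun U _ => ?_
    split_ifs with hU
    · rfl
    · exact sum_eq_zero fun M _ => levelWeight_eq_zero_of_card_ne C w hU M
  have hAtcard : ∀ U ∈ A.filter (fun U => U.1.card = 2 * c' + 1), U.1.card = 2 * c' + 1 := fun U hU => (mem_filter.1 hU).2
  have hAtB : ∀ U ∈ A.filter (fun U => U.1.card = 2 * c' + 1), ∀ M ∈ B, cc U M ≠ 1 :=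
    fun U hU M hM => hAB U (mem_filter.1 hU).1 M hM
  -- the three-term bound
  have h3 := abs_value_le_three_terms hev hn1 hex hDg hDg4 hbal hq40 hN₁q hτ0 hSNT hβ (Real.exp_pos _).le
    (A.filter fun U => U.1.card = 2 * c' + 1) hAtcard B hAtB Dk
  -- the attenuation `P_{D−4} ≤ (2/D³)^κ`
  have hκn : 4 * ((dq n - 4) / 2 + 1) ≤ n := by omega
  have hκ2D : 4 * ((dq n - 4) / 2 + 1) ≤ 2 * dq n := by omega
  have hP := atten_le_pow (n := n) hκn
  have hDpos : (0 : ℝ) < dq n := by exact_mod_cast (show 0 < dq n by omega)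
  have hn0 : (0 : ℝ) < n := by exact_mod_cast (show 0 < n by omega)
  have hD4R : (dq n : ℝ) ^ 4 ≤ n := by exact_mod_cast hD4n
  have hratio : (4 * (((dq n - 4) / 2 + 1 : ℕ) : ℝ)) / n ≤ 2 / (dq n : ℝ) ^ 3 := by
    rw [div_le_div_iff₀ hn0 (by positivity)]
    have h1 : (4 * (((dq n - 4) / 2 + 1 : ℕ) : ℝ)) ≤ 2 * dq n := by exact_mod_cast hκ2D
    calc 4 * (((dq n - 4) / 2 + 1 : ℕ) : ℝ) * (dq n : ℝ) ^ 3 ≤ 2 * dq n * (dq n : ℝ) ^ 3 :=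
          mul_le_mul_of_nonneg_right h1 (by positivity)
      _ = 2 * (dq n : ℝ) ^ 4 := by ring
      _ ≤ 2 * n := by linarith
  have hP0 : 0 ≤ ∏ i ∈ range ((dq n - 4) / 2 + 1), ((2 * i + 1 : ℝ) / ((n : ℝ) - 2 * i)) := atten_nonneg (by omega)
  have hP2 := hP.trans (pow_le_pow_left₀ (by positivity) hratio _)
  have hP' : (∏ i ∈ range ((dq n - 4) / 2 + 1), ((2 * i + 1 : ℝ) / ((n : ℝ) - 2 * i))) * (dq n : ℝ) ^ (3 * ((dq n - 4) / 2 + 1)) ≤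
      (2 : ℝ) ^ ((dq n - 4) / 2 + 1) := by
    calc _ ≤ (2 / (dq n : ℝ) ^ 3) ^ ((dq n - 4) / 2 + 1) * (dq n : ℝ) ^ (3 * ((dq n - 4) / 2 + 1)) :=
          mul_le_mul_of_nonneg_right hP2 (by positivity)
      _ = (2 : ℝ) ^ ((dq n - 4) / 2 + 1) := by
          rw [div_pow, ← pow_mul, div_mul_cancel₀]
          exact pow_ne_zero _ hDpos.ne'
  -- the three terms
  have hT1 := remainder_term_le hq1
  have hq2' : (q : ℝ) + 1 ≤ c₀ / 80 * dq n + 6 := by rw [ha] at hq2; exact hq2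
  have hT2 := junk_term_le (D := (dq n : ℝ)) hc₀1 hcD hq2'
  rw [← ha] at hT2
  have hT3 := crossing_term_le (a := a) hP0 hP' (by omega : 2 ≤ dq n) hn16 hκ (by linarith)
  rw [hAeq]
  refine (le_abs_self _).trans (h3.trans ?_)
  linarith

/-- **The crux at every bounded dimension, modulo Keevash–Lifshitz Thm 1.8**: combining the `r = 1` rung with the tree's grid amplification
`tracialDecay_boundedDim_of_rectangleDecay`, for some `a > 0` and every `r₀`, for all large even `n` every balanced `B = 20` design weight has
tracial value `≤ exp(−(a/(8(r₀+1)))·dq n)` on tight-orthogonal psd rectangles of every dimension `1 ≤ r ≤ r₀`. (The crux `TracialDecayExp20` asks this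
with ONE rate for all `r² n < exp(a·dq n)`; that growth of `r` with `n` is the open part.) [cite: Rothvoss2017, §2 (PDF p. 6)] [cite: KeevashLifshitz2023, Thm. 1.8] -/
theorem tracialDecayExp_boundedDim_of_globalLevelD (hKL : GlobalLevelDInequality) :
    ∃ a : ℝ, 0 < a ∧ ∀ r₀ : ℕ, ∃ n₁ : ℕ, ∀ n : ℕ, n₁ ≤ n → Even n → ∀ (t : ℕ) (C : Finset ℕ) (w : ℕ → ℝ),
      IsBalancedDesign n t (Tq n) (dq n) 20 C w → ∀ r : ℕ, 0 < r → r ≤ r₀ →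
        TracialValueLEAt (levelWeight n t C w) (Real.exp (-(a / (8 * ((r₀ : ℝ) + 1)) * (dq n : ℝ)))) r := by
  obtain ⟨a, ha, n₁, h⟩ := rectangleDecayExp_of_globalLevelD hKL
  exact ⟨a, ha, fun r₀ => tracialDecay_boundedDim_of_rectangleDecay ha r₀ ⟨n₁, h⟩⟩

end Summit.PneNP.PneNP.Theorems.ChebyshevTracialDesignRungAssembly
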